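import Literature.NumberTheory.EllipticCurves.SelmerProofs
import Literature.NumberTheory.EllipticCurves.BSDRankZeroDensity
import HarnessLib

/-!
# The COUPLED Cassels–Tate telescope, XIX: the RESIDUE's «ℚ-KUMMER FIVE» as TREE THEOREMS (for any
# `E/ℚ` at level `n = 4^κ`; rows' leaf of `RESIDUE c`, files `…TailFourOfResidue` / `…TailSevenOfResidue`)

Crux `UpperOffV0HSYPlus` (stmt-BirchSwinnertonDyer-19804).  The rows' display hR (RESIDUE c) ends, per
curve, with #K11's five `ℚ`-Kummer inputs at `T := 2κ`:
`y ∈ Sel_n(E/ℚ)`, `torsionH1ToH1 E n y = 0`, `a • y = 0 → 2^{2κ} ∣ a ∨ y = 0`,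
`∀ u ∈ Sel_n(E/ℚ), torsionH1ToH1 E n u = 0 → ∃ a, u = a • y`.  This file proves them for ANY
Weierstrass curve `E` over a number field `F` (for hR: `F = ℚ`) WITHOUT rational `2`-torsion (`h2`);
the field is kept GENERIC so that every instance on `E(F)` is the tree's classical one (the convention
of `kummerMapTorsion` and of the displays):

* `zsmul_level_surjective_on_torsion` — a rational torsion point of a curve without rational `2`-torsion
  is `4^κ`-divisible in `E(ℚ)` (its order is odd, Bezout);
* `kummerFive_of_generator` — B-SHAPE: if `g ∈ E(F)` is non-torsion and generates `E(ℚ)` modulo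
  torsion, the five hold with `y := kummerMapTorsion E n _ g` (Kummer exactness: tree
  `kummerMapTorsion_mem_selmerLocalKer`, `torsionH1ToH1_kummerMapTorsion`,
  `mem_range_kummerMapTorsion_of_torsionH1ToH1_eq_zero`, `kummerMapTorsion_ker`);
* `kummerFive_of_torsion` — A-SHAPE: if `E(ℚ)` is torsion, the five hold with `y := 0`.

The rows feed hR by one call each (their inputs: the generator of `(cubeSumCurve p)(ℚ)` transported
from `P` along `CB`, «no rational 2-torsion on `cubeSumCurve ·`» = `HuShuYin2019.cubeSumCurve_eq_zero_
of_two_smul_eq_zero` at `F = ℚ`, and «`(cubeSumCurve (3p²))(ℚ)` is torsion» = Rubin's CM rank-0 triple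
from `PublishedFactsTwoPlus`, which stays THEIR call).  Theorem-only (no definition, no named fact);
nothing asserted on 19804; no stub closed; X12.CMAtTwo NOT proved; BSD not claimed for any curve.
Sources: Silverman AEC VIII.§2 (Kummer sequence), X.4.2; McCallum 1991 §5 (p. 288: `E(K)/p^M E(K)` cyclic
generated by the Heegner point); MEMO-bsd-cm-two §59.2.
-/

-- every Summits module is named `Summit.<Summit>.<Problem>…`: the duplicated component is by design
set_option linter.dupNamespace false
set_option autoImplicit false

noncomputable section

open scoped Classical

open WeierstrassCurve Literature.NumberTheory.EllipticCurves NumberField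

namespace Summit.BirchSwinnertonDyer.BirchSwinnertonDyer.Theorems.SylvesterTwoCoupledTelescope

section KummerFive

variable {F : Type} [Field F] [NumberField F] (E : WeierstrassCurve F) (κ : ℕ)

omit [NumberField F] in
/-- **A rational torsion point is `4^κ`-divisible when `E(F)[2] = 0`**: its order is odd (a point of
even order `2e` yields the `2`-torsion point `e • T`), hence coprime to `4^κ`, and Bezout
(`exists_nsmul_eq_self_of_coprime`) writes `T = 4^κ • (m • T)`. [cite: SilvermanAEC2009, §VIII.2] -/
theorem zsmul_level_surjective_on_torsion
    (h2 : ∀ P : E.toAffine.Point, 2 • P = 0 → P = 0)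
    (T : E.toAffine.Point) (hT : IsOfFinAddOrder T) :
    ∃ T' : E.toAffine.Point, ((2 ^ κ * 2 ^ κ : ℕ) : ℤ) • T' = T := by
  -- the order of `T` is odd
  have hd := hT.addOrderOf_pos
  have hodd : ¬ 2 ∣ addOrderOf T := by
    rintro ⟨e, he⟩
    have heT : e • T = 0 := by
      apply h2
      rw [← mul_nsmul', ← he]
      exact addOrderOf_nsmul_eq_zero T
    have hdvd : addOrderOf T ∣ e := addOrderOf_dvd_of_nsmul_eq_zero heT
    rw [he] at hdvd
    rcases Nat.eq_zero_or_pos e with h0 | hpos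
    · rw [he, h0, mul_zero] at hd
      exact lt_irrefl 0 hd
    · exact absurd (Nat.le_of_dvd hpos hdvd) (by omega)
  have hcop : (2 ^ κ * 2 ^ κ).Coprime (addOrderOf T) := by
    rw [← pow_add]
    exact Nat.Coprime.pow_left _ (Nat.prime_two.coprime_iff_not_dvd.mpr hodd)
  obtain ⟨m, hm⟩ := exists_nsmul_eq_self_of_coprime hcop
  refine ⟨m • T, ?_⟩
  rw [natCast_zsmul, ← mul_nsmul', mul_comm, mul_nsmul', hm]

/-- **The `ℚ`-Kummer five, B-SHAPE** (module docstring): for `E/ℚ` without rational `2`-torsion and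
`g ∈ E(F)` non-torsion generating `E(ℚ)` modulo torsion, the class `y := δ_n g` (`n = 4^κ`) is Selmer,
dies in `H¹(ℚ, E)`, is free of exponent `2^{2κ}`, and generates `Sel_n(E/ℚ) ∩ ker (H¹(ℚ, E[n]) → H¹(ℚ, E))`
— #K11's `(hy, hτy, hfree, hker)` at `T := 2κ`.  WHERE THE HYPOTHESES ARE CONSUMED (D643 (ii)):
`hfree` uses BOTH `hg` (from `a • δ g = 0`: `a • g = n • Q`, `Q = m • g + T` ⇒ `(a - n m) • g` is torsion
⇒ `a = n m` since `g` is not) and `h2` (through `zsmul_level_surjective_on_torsion`: the torsion part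
`T` is `n`-divisible, so `n • (Q - m • g)` is torsion); `hker` uses `hgen` and `h2` (`δ` kills the odd-order
torsion); the Selmer and `H¹(ℚ, E)` clauses use neither. [cite: SilvermanAEC2009, §VIII.2 and Thm X.4.2(a)]
[cite: McCallumLMS1991, §5 Thm. 5.4 (proof, p. 288)] -/
theorem kummerFive_of_generator [E.IsElliptic]
    (h2 : ∀ P : E.toAffine.Point, 2 • P = 0 → P = 0)
    (g : E.toAffine.Point) (hg : ¬ IsOfFinAddOrder g)
    (hgen : ∀ Q : E.toAffine.Point, ∃ m : ℤ, IsOfFinAddOrder (Q - m • g)) :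
    kummerMapTorsion E ((2 ^ κ * 2 ^ κ : ℕ) : ℤ) (E.zsmul_geomPoints_surjective_of_charZero
        (Int.natCast_ne_zero.mpr (mul_ne_zero (pow_ne_zero κ two_ne_zero) (pow_ne_zero κ two_ne_zero)))) g ∈
      selmerGroup E ((2 ^ κ * 2 ^ κ : ℕ) : ℤ) ∧
    torsionH1ToH1 E ((2 ^ κ * 2 ^ κ : ℕ) : ℤ) (kummerMapTorsion E ((2 ^ κ * 2 ^ κ : ℕ) : ℤ)
        (E.zsmul_geomPoints_surjective_of_charZero (Int.natCast_ne_zero.mpr (mul_ne_zero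
          (pow_ne_zero κ two_ne_zero) (pow_ne_zero κ two_ne_zero)))) g) = 0 ∧
    (∀ a : ℤ, a • kummerMapTorsion E ((2 ^ κ * 2 ^ κ : ℕ) : ℤ) (E.zsmul_geomPoints_surjective_of_charZero
        (Int.natCast_ne_zero.mpr (mul_ne_zero (pow_ne_zero κ two_ne_zero) (pow_ne_zero κ two_ne_zero)))) g = 0 →
      ((2 : ℤ) ^ (2 * κ) ∣ a) ∨ kummerMapTorsion E ((2 ^ κ * 2 ^ κ : ℕ) : ℤ)
        (E.zsmul_geomPoints_surjective_of_charZero (Int.natCast_ne_zero.mpr (mul_ne_zero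
          (pow_ne_zero κ two_ne_zero) (pow_ne_zero κ two_ne_zero)))) g = 0) ∧
    (∀ u ∈ selmerGroup E ((2 ^ κ * 2 ^ κ : ℕ) : ℤ), torsionH1ToH1 E ((2 ^ κ * 2 ^ κ : ℕ) : ℤ) u = 0 →
      ∃ a : ℤ, u = a • kummerMapTorsion E ((2 ^ κ * 2 ^ κ : ℕ) : ℤ)
        (E.zsmul_geomPoints_surjective_of_charZero (Int.natCast_ne_zero.mpr (mul_ne_zero
          (pow_ne_zero κ two_ne_zero) (pow_ne_zero κ two_ne_zero)))) g) := by
  have hn : (((2 ^ κ * 2 ^ κ : ℕ) : ℤ)) ≠ 0 := Int.natCast_ne_zero.mpr (mul_ne_zero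
    (pow_ne_zero κ two_ne_zero) (pow_ne_zero κ two_ne_zero))
  have h2κ : ((2 : ℤ) ^ (2 * κ)) = ((2 ^ κ * 2 ^ κ : ℕ) : ℤ) := by push_cast; ring
  -- `δ` kills the rational torsion (it is `n`-divisible and `H¹(ℚ, E[n])` is `n`-torsion)
  have hδT : ∀ T : E.toAffine.Point, IsOfFinAddOrder T →
      kummerMapTorsion E ((2 ^ κ * 2 ^ κ : ℕ) : ℤ) (E.zsmul_geomPoints_surjective_of_charZero hn) T = 0 := by
    intro T hT
    obtain ⟨T', rfl⟩ := zsmul_level_surjective_on_torsion E κ h2 T hT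
    rw [map_zsmul]
    exact zsmul_galH1Torsion_eq_zero _ _ _
  refine ⟨?_, torsionH1ToH1_kummerMapTorsion _ _ _ g, fun a ha ↦ ?_, fun u hu hτu ↦ ?_⟩
  · -- Selmer: the Kummer class satisfies every local condition
    rw [mem_selmerGroup_iff]
    exact ⟨fun v ↦ kummerMapTorsion_mem_selmerLocalKer _ _ _ _ g,
      fun w ↦ kummerMapTorsion_mem_selmerLocalKer _ _ _ _ g⟩
  · -- freeness of exponent `2^{2κ}`: `a • δ g = δ (a • g) = 0` puts `a • g` in `n E(ℚ)`
    refine Or.inl ?_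
    have hker : a • g ∈ (kummerMapTorsion E ((2 ^ κ * 2 ^ κ : ℕ) : ℤ)
        (E.zsmul_geomPoints_surjective_of_charZero hn)).ker := by
      rw [AddMonoidHom.mem_ker, map_zsmul]
      exact ha
    rw [kummerMapTorsion_ker] at hker
    obtain ⟨Q, hQ⟩ := hker
    change ((2 ^ κ * 2 ^ κ : ℕ) : ℤ) • Q = a • g at hQ
    obtain ⟨m, hm⟩ := hgen Q
    -- `a • g = n • Q = n • (m • g + T)`, so `(a - n m) • g = n • T` is torsion; `g` is not
    have hT : IsOfFinAddOrder (((2 ^ κ * 2 ^ κ : ℕ) : ℤ) • (Q - m • g)) := hm.zsmul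
    have heq : (a - ((2 ^ κ * 2 ^ κ : ℕ) : ℤ) * m) • g = ((2 ^ κ * 2 ^ κ : ℕ) : ℤ) • (Q - m • g) := by
      rw [sub_zsmul, zsmul_sub, mul_zsmul, hQ]
      abel
    rw [← heq] at hT
    by_cases hc : a - ((2 ^ κ * 2 ^ κ : ℕ) : ℤ) * m = 0
    · rw [h2κ]
      exact ⟨m, by linear_combination hc⟩
    · exfalso
      apply hg
      obtain ⟨k, hk, hk0⟩ := hT.exists_nsmul_eq_zero
      rw [isOfFinAddOrder_iff_zsmul_eq_zero]
      refine ⟨(k : ℤ) * (a - ((2 ^ κ * 2 ^ κ : ℕ) : ℤ) * m), mul_ne_zero (by exact_mod_cast hk.ne') hc, ?_⟩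
      rw [mul_zsmul, natCast_zsmul, hk0]
  · -- `ker (Sel_n → H¹(ℚ, E)) = δ(E(ℚ)) = ℤ δ g`
    obtain ⟨Q, rfl⟩ := mem_range_kummerMapTorsion_of_torsionH1ToH1_eq_zero E _
      (E.zsmul_geomPoints_surjective_of_charZero hn) u hτu
    obtain ⟨m, hm⟩ := hgen Q
    refine ⟨m, ?_⟩
    have hQ : Q = m • g + (Q - m • g) := by abel
    rw [hQ, map_add, map_zsmul, hδT _ hm, add_zero]

/-- **The `ℚ`-Kummer five, A-SHAPE**: for `E/ℚ` without rational `2`-torsion and with `E(ℚ)` torsion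
(rank `0`), the five hold with `y := 0` — every Selmer class dying in `H¹(ℚ, E)` is a Kummer class of a
torsion point, hence `0`. [cite: SilvermanAEC2009, §VIII.2 and Thm X.4.2(a)] -/
theorem kummerFive_of_torsion [E.IsElliptic]
    (h2 : ∀ P : E.toAffine.Point, 2 • P = 0 → P = 0)
    (htor : ∀ Q : E.toAffine.Point, IsOfFinAddOrder Q) :
    (0 : galH1Torsion E ((2 ^ κ * 2 ^ κ : ℕ) : ℤ)) ∈ selmerGroup E ((2 ^ κ * 2 ^ κ : ℕ) : ℤ) ∧
    torsionH1ToH1 E ((2 ^ κ * 2 ^ κ : ℕ) : ℤ) 0 = 0 ∧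
    (∀ a : ℤ, a • (0 : galH1Torsion E ((2 ^ κ * 2 ^ κ : ℕ) : ℤ)) = 0 →
      ((2 : ℤ) ^ (2 * κ) ∣ a) ∨ (0 : galH1Torsion E ((2 ^ κ * 2 ^ κ : ℕ) : ℤ)) = 0) ∧
    (∀ u ∈ selmerGroup E ((2 ^ κ * 2 ^ κ : ℕ) : ℤ), torsionH1ToH1 E ((2 ^ κ * 2 ^ κ : ℕ) : ℤ) u = 0 →
      ∃ a : ℤ, u = a • (0 : galH1Torsion E ((2 ^ κ * 2 ^ κ : ℕ) : ℤ))) := by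
  have hn : (((2 ^ κ * 2 ^ κ : ℕ) : ℤ)) ≠ 0 := Int.natCast_ne_zero.mpr (mul_ne_zero
    (pow_ne_zero κ two_ne_zero) (pow_ne_zero κ two_ne_zero))
  refine ⟨zero_mem _, map_zero _, fun _ _ ↦ Or.inr rfl, fun u _ hτu ↦ ⟨0, ?_⟩⟩
  obtain ⟨Q, rfl⟩ := mem_range_kummerMapTorsion_of_torsionH1ToH1_eq_zero E _
    (E.zsmul_geomPoints_surjective_of_charZero hn) u hτu
  obtain ⟨T', rfl⟩ := zsmul_level_surjective_on_torsion E κ h2 Q (htor Q)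
  rw [zero_smul, map_zsmul]
  exact zsmul_galH1Torsion_eq_zero _ _ _

end KummerFive

end Summit.BirchSwinnertonDyer.BirchSwinnertonDyer.Theorems.SylvesterTwoCoupledTelescope

end
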